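import Literature.NumberTheory.EllipticCurves.Sprung2012.SharpFlatColemanKatoZetaJoint
import Literature.NumberTheory.EllipticCurves.Sprung2012.SharpFlatSelmerDualInvolutionTwistProofs
import HarnessLib

/-!
# Sprung 2012, §7.2 at the trivial character — the Kato side in PRINT-EXACT keying: the Poitou–Tate
# sequence (3) of Thm. 7.14 / Prop. 7.19 (with Def. 6.1, Props. 7.3/7.6, Kato's Thm. 12.6 zeta submodule)
# and Thm. 7.16 (= Thm. 1.4 for `n = 0`), on the Pontryagin duals `X^•(E/ℚ_∞)`, `X₀(E/ℚ_∞)` WITH THEIR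
# CONTRAGREDIENT `Λ`-STRUCTURE (`D : SharpFlatSelmerDualData W κ γ⁻¹ …`, `Y : W.FineSelmerDualData κ γ⁻¹`
# against the covariant `I : Kato2004.IwasawaH1Data W p κ γ`, `1 + T ↦ γ ↦ 1 + X`)

Topic `Literature/NumberTheory/EllipticCurves`, cluster `Sprung2012` (namespace = path). ONE new leaf file
(D-0064: one file for the source section §7.2), imported by nobody at filing time. SIBLING of three landed
statement files of this directory, none of which is edited (D-0014: a fact's meaning is never changed in
place; their consumers are untouched):
`SharpFlatColemanKatoZeta.lean` (cell `bsd-print-x8`, p543968: hypothesis structure `SharpFlatColemanKatoData` +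
construction fact `thm714seq_sharpFlatColemanKato_zeta`), `SharpFlatColemanKatoZetaJoint.lean` (p608011: the
two-colour reading `thm714seq_sharpFlatColemanKato_zetaJoint` + proved projection), and
`SharpFlatKatoDivisibility.lean` (cell `bsd-littype`: `thm714_sharpFlatSelmerDual_finite_torsion` = Thm. 1.2 /
7.14, `thm716_sharpFlatCharIdeal_divisibility` = Thm. 7.16 / 1.4). THIS FILE, their CONTRAGREDIENT TWINS:
* §1 one hypothesis STRUCTURE `SharpFlatColemanKatoDataContra` — `SharpFlatColemanKatoData` FIELD FOR FIELD
  (names, types, docstrings), with the ONE change that the Poitou–Tate field `exact` quantifies over the dual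
  data keyed by `γ⁻¹` — and TWO named CONSTRUCTION facts (`def … : Prop`, D-0014; nothing asserted, no
  `_holds`) = the siblings' facts VERBATIM with `…DataContra` for `…Data`:
  `thm714seq_sharpFlatColemanKato_zeta_contra` (one colour at a time) and
  `thm714seq_sharpFlatColemanKato_zetaJoint_contra` (both colours on ONE zeta submodule), plus the PROVED
  projection `thm714seq_sharpFlatColemanKato_zeta_contra_of_joint`;
* §2 ONE named fact `thm716_sharpFlatCharIdeal_divisibility_contra` — `thm716_sharpFlatCharIdeal_divisibility`
  LETTER FOR LETTER except `D : SharpFlatSelmerDualData W κ γ⁻¹ (closureEmb …) (a_p) g c •` — with PROVED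
  one-line consequences `.rational`, `.integral`, `.dvd_of_charIdeal_eq_span`, `.exists_dvd_pow_mul`,
  `.of_thm714` (torsion hypotheses discharged by the keying-IMMUNE Thm. 7.14 fact through the tree's
  `ι`-dictionary), `.exists_datum_dvd` (non-vacuity), `.invol_rational` / `.invol_integral` (the fact READ ON A
  TREE-KEYED datum: `pⁿ·ι(L^•) ∈ char`).
Net debt +3 (three statement-only facts); 9 theorems proved. Pattern, token for token, of the landed
`a_p = 0` twin `Kobayashi2003/SignedColemanKatoZetaContragredient.lean` (`SignedColemanKatoDataContra`,
`thm62_63_73_signedColemanKato_zeta_contra`, flag `Kob03-721-dual-action`) and of the Kato twins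
`Kato2004/{EulerSystemBoundFineSelmer(Two)Contragredient, DivisibilityInputsContragredient,
ZetaSideInputsContragredient}.lean` (`D : … κ γ⁻¹`, `Y : W.FineSelmerDualData κ γ⁻¹` against the covariant
`I : Kato2004.IwasawaH1Data W p κ γ`; flags `Kato-134-dual-action`, `Kato-1713-dual-action`). Filed by cell
`bsd-print-x8` (HOME `run/shared/lean/pub/bsd-print-x8/`), seat `bsd-input-x8-contra-ty` (literature typer;
director-bsd (259)(c) / (261)(3) / (267)(c): «cite F15 / F17 / F82 ONLY as re-keyed C′», «the three `_contra`
decls + `SharpFlatColemanKatoDataContra` in ONE file»), executing the cell referee's turnkey R-250 §4 C′-1 /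
C′-2 / §7 (`HOME/ref/REF-G24-R250-KEYING-DECIDED.md`, sha16 8d240454f2db9ef3), the vet's V1 = YES ⇒ RE-KEY
(`HOME/bsd-vet-x8-hg/VET-X8-HG-g0.md` §5–§6) and the INPUTS desk rows F15 / F17 / F82 = G1
(`pub/bsd-wall/bsd-inputs/INPUTS-LIST-2-ADDENDUM-30.md` §A). HONEST FRAMING: TRANSCRIPTIONS of published
theorems as named facts; nothing of Sprung, Kobayashi or Kato is proved here; typing them makes their consumers
(route `PrintX8VS`: items 20415 / 20772, conjunct (5) of 23004 / 20403, conjunct 2 of 23113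
`HeldFactsKatoSporadicX8`, guard 2 of 23112, conjunct (iii) `hJ` of 22571, the `I, Cs, Cf, Cs.Z = Cf.Z` / `D` /
`Y` binders of the 19875-family — once the planner re-binds them) conditional on PRINT-FAITHFUL statements AS
TYPED and nothing more; no X8 cell moves; NO summit statement (`BirchSwinnertonDyer`), no K1, no K_spor is
proved by anything in this file. No instance, no notation, no attribute is declared or removed. Typed ≠ proved
≠ endorsed; an AI-typed statement is established only by the kernel checking its uses.

## The point (reading flags `Sp12-714seq-dual-action`, `Sp12-716-dual-action`; the same derivation as
## `Kob03-721-dual-action` of the `a_p = 0` twin and `Kato-134-dual-action` / `Kato-1713-dual-action` of the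
## Kato twins, whose module docstrings quote Kato verbatim)

Sprung's (3) (p. 1504), `0 → 𝐇¹(T)^η →^ι H¹_Iw(T)^η/Ker ε_η Col^∗ → X^∗(E/K_∞)^η → X⁰(E/K_∞)^η → 0`, is "the
exact sequence of `ℤ_p[[X]]`-modules" obtained "From [Kobayashi, Proposition 7.1 and the limit of (7.18)]" and
the Cassels–Poitou–Tate sequence — Poitou–Tate duality along the tower, following Kurihara; Kato (14.9.3),
(17.13.1) "a sequence of `Λ`-modules" —; Prop. 7.19 (p. 1505) is (3) with the Coleman isomorphism
`H¹_Iw(T)^{η=1}/Ker ε_1 Col^• ≃ ℤ_p[[X]]` (Props. 7.3/7.6) composed in and `Z(T)` quotiented out; Thm. 7.16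
(p. 1504) follows from Prop. 7.19, Kurihara's Prop. 7.17 (`𝐇²(T) ≅ X⁰`) and Kato's Thm. 7.18 = [Ka, Thm. 12.5].
Iwasawa cohomology (`𝐇¹`, `H¹_Iw`) carries the natural (covariant) Galois action [Kato §12.2 p. 220, §17.13
p. 279]; the tree pins it as `I : Kato2004.IwasawaH1Data W p κ γ` with `T = conj_γ − 1`, `1 + T ↦ γ`
(`IwasawaH1Data.proj_T_smul`), and Sprung's Coleman maps and `L^{♯/♭}_p(E, X)` live on that side with `γ`
NORMALISED TO SPRUNG'S `X` (`IsCyclotomicVariable p γ`: "fix a topological generator `γ` of `Γ`. By sending `γ`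
to `(1 + X)` …", p. 1486) — so that `Col^•(z_Kato) = L^•_p(E, X)` (Def. 6.1) holds VERBATIM, with no `ι` (the
sibling's and this file's field `image_zeta_localized`; `colMap : I.H →ₗ[Λ] Λ`). Duality pairings being
functorial (invariant under transport of structure by `σ ∈ Gal(ℚ̄/ℚ)`), the duality maps carry the natural action
to the CONTRAGREDIENT action `x ↦ x ∘ conj_{σ⁻¹}` on the Pontryagin duals `X^∗ = Hom(Sel^∗, ℚ_p/ℤ_p)`
(Def. 7.11, p. 1503), `X⁰` (Def. 7.13) — the structure for which (3) / Prop. 7.19 ARE `Λ`-linear and about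
which Thm. 7.16 speaks. The tree's dual data `SharpFlatSelmerDualData W κ γ' ι ap g c •` /
`W.FineSelmerDualData κ γ'` have `T` acting by PRE-composition with `conj_{γ'}`
(`SharpFlatSelmerDualData.toDual_T_smul`: `(T·x)(s) = x(conj_{γ'} s) − x(s)`; `FineSelmerDualData.toDual_T_smul`),
i.e. by the contragredient action of `γ'⁻¹`. Hence, with `1 + T ↦ γ` throughout, the `X^•(E/ℚ_∞)`, `X₀(E/ℚ_∞)`
OF PRINT are the data of key `γ' = γ⁻¹` — `D : SharpFlatSelmerDualData W κ γ⁻¹ …`, `Y : W.FineSelmerDualData κ γ⁻¹`,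
the binders below —, while data of key `γ` are their Iwasawa-involution twists `(X^•)^ι`, `(X₀)^ι`
[Greenberg1989 pp. 101–102: "`S^ι` … the `Λ`-module with the same underlying set as `S` but with `Λ` acting
through `ι`", `ι(γ) = γ⁻¹`]. The siblings quantify over `D`, `Y` with `γ` there: their `exact` is the printed
(3) composed with `ι` out of `Λ` (it agrees with print iff the ideal `colMap(𝐇¹) ⊆ Λ` is `ι`-symmetric prime by
prime — unprinted), and their `thm716_…` says «`pⁿ·L^• ∈ char((X^•)^ι)`», i.e. «`pⁿ·ι(L^•) ∈ Char X^•`» (it agrees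
with the printed «`Char X^• ⊇ (pⁿ L^•)`» iff `Char X^•` is `ι`-symmetric — unprinted; the cell's referee and vet
read both sibling typings as failing in nature at every X8 pair with a private sporadic zero, `Col^•(z_Kato)`
being the Mazur–Tate ♯/♭ pair VERBATIM in either orientation of Kato's reciprocity law — R-250 §1–§3 with lit
T67, vet §5; statement-level findings, not kernel theorems). The PROVED tree dictionary
`Sprung2012/SharpFlatSelmerDualInvolutionTwistProofs.lean` (`sharpFlatSelmerDualData_mem_charIdeal_inv_iff`:
`f ∈ char D.X ↔ ι f ∈ char D₀.X` for `D₀` of key `γ`, `D` of key `γ⁻¹`; `…_finite_inv_iff`, `…_isTorsion_inv_iff`,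
`…_lengthAt_inv_eq`) makes the relation kernel-exact (§2: `.invol_rational`), and shows that torsion-ness and
finite generation (Thm. 7.14) are `ι`-invariant: `thm714_sharpFlatSelmerDual_finite_torsion` is keying-IMMUNE and
discharges the displayed torsion hypotheses of `thm716_…_contra` (`.of_thm714`); no `thm714` twin is typed. The
other fields of the structure (`colMap`, `colMap_injective`, `Z`, `zeta_le_span`, `image_zeta_localized`)
involve `𝐇¹` and ideals of `Λ` only and are repeated VERBATIM. All the siblings' reading flags
(`Sp12-eta1-Ftower`, `Sp12-61-eta1-ideal-localized`, `Sp12-714seq-eta1-maps-existential`, period register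
`Sp12-716-period` with `ϖ` explicit resp. absorbed by units) apply verbatim.

## Source, verbatim (F. E. I. Sprung, *Iwasawa theory for elliptic curves at supersingular primes: A pair of
## main conjectures*, J. Number Theory 132 (2012) 1483–1506 [Sprung2012]; held copy
## `paper:doi-10-1016-j-jnt-2011-11-003`, PDF page NN = printed page 1482 + NN, re-read by this seat
## 2026-08-28: p0022 = p. 1504 L12–L36 (Thm. 7.14 with (3)), L40–L71 (Thm. 7.16), L74–L87 (Prop. 7.17,
## Thm. 7.18); p0023 = p. 1505 L5–L19 (Prop. 7.19); the ♯/♭ glyphs and «≠» are LOST in that text layer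
## (`∗ ∈ {♯, ♭}`; clean-glyph controls as in the siblings: arXiv:0903.3419v1 Thm. 57, arXiv:1106.1936 Prop.
## 19); the siblings' module docstrings quote Def. 5.9, 6.1, Main Thm. 6.12, Prop. 6.14, Def. 7.1, Props.
## 7.3/7.6, Def. 7.9–7.13, Thm. 1.2/1.4 in full)

Thm. 7.14, proof (p. 1504): "From [Kobayashi, Proposition 7.1 and the limit of (7.18)], we have the exact
sequence `𝐇¹(T)^η → H¹_Iw(T)^η → X(E/K_∞)^η → X⁰(E/K_∞)^η → 0` … the arguments in the proof of [Kobayashi,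
Theorem 7.3 i] provide us with an injection `ι` in the exact sequence of `ℤ_p[[X]]`-modules
`0 → 𝐇¹(T)^η →^ι H¹_Iw(T)^η / Ker ε_η Col^∗ → X^∗(E/K_∞)^η → X⁰(E/K_∞)^η → 0`. (3) To see that the entire
sequence is exact, we can use the Cassels–Poitou–Tate exact sequence (cf. [PR, Appendix A.3.2] or [CS, Theorem
1.5]) and the discussion in [Kobayashi] preceding (7.16)." Thm. 7.16 (p. 1504): "Let `p` be an odd
supersingular prime, and `∗ ∈ {♯, ♭}` so that `L^∗_p(E, η, X) ≠ 0`. Then for some integer `n ⩾ 0`,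
`Char X^∗(E/K_∞)^η ⊇ (pⁿ (1/X) L^∗_p(E, η, X))` if `∗ = ♯`, `η ≠ 1` [text layer: "η = 1"; the exceptional case
is `η ≠ 1`, cf. Prop. 7.6 / Prop. 7.19 "if `∗ = ♯, η ≠ 1`" and Kobayashi's Thm. 4.1], and `a_p = 0`,
`Char X^∗(E/K_∞)^η ⊇ (pⁿ L^∗_p(E, η, X))` for all other cases. Further, if the `p`-adic representation
`Gal(ℚ̄/ℚ) → GL_{ℤ_p}(T)` on the automorphism group of the `p`-adic Tate module `T` is surjective, we can take
`n = 0`." Thm. 1.4 (p. 1486): "… Then if the `p`-adic representation … is surjective, we have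
`Char(X^∗(E/ℚ_∞)) ⊇ (L^∗_p(E, X))`." Prop. 7.19 (p. 1505): "Choose `∗ ∈ {♯, ♭}` so that `L^∗_p(E, η, X) ≠ 0`.
Then there are exact sequences … `0 → 𝐇¹(T)^η/Z(T)^η → Λ^η/L^∗_p(E, η, X) → X^∗(E/K_∞)^η → X⁰(E/K_∞)^η → 0` if
not [`∗ = ♯, η ≠ 1`]. *Proof.* This follows from the exact sequence (3) in the proof of Theorem 7.14, Proposition
7.3, and Proposition 7.6." K. Kato, Astérisque 295, §12.2 (p. 220): "`𝐇¹(T)` and `𝐇²(T)` are finitely generated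
`ℤ_p[[G_∞]]`-modules"; §17.13 (p. 279): "we obtain a sequence of `Λ`-modules (17.13.1) …". R. Greenberg, Adv.
Stud. Pure Math. 17 (1989) pp. 101–102: "If `S` is any `Λ`-module, we define `S^ι` as the `Λ`-module with the
same underlying set as `S` but with `Λ` acting through `ι`."

## Transcription (tree vocabulary only; IDENTICAL to the siblings', binder for binder, except the key of `D`, `Y`)

Setting of `thm22_exists_isHondaSystem` / the siblings: `W/ℚ` elliptic, globally minimal (`a_p = W.frobeniusTrace
p`; for §1 the structure facts of `T_pW` as instance BINDERS); `p ≠ 2` of good reduction with `p ∣ a_p` (ANY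
supersingular `a_p`, in particular `(3, ±3)`); the newform `f` of `W` (§1: with period ratio `ϖ`,
`ϖ·Ω_E = Ω⁺_f`, carried explicitly); the cyclotomic `ℤ_p`-extension `κ` with topological generator `γ` NORMALISED
TO THE CYCLOTOMIC VARIABLE (`IsCyclotomicVariable p γ` — this ties `γ`, not `γ⁻¹`, to Sprung's `X`, hence to
`Col^•` and `L^{♯/♭}_p`); the place `v ∣ p`, a local lift `g` of `γ`, a Honda system `(cneg, c)` — the data through
which `Ker Col^•`, `E^•_{∞,𝔭}` and `Sel^•` are DEFINED (`Sprung2012/ColemanMaps.lean`, `SharpFlatSelmer.lean`; these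
definitions do not involve the key); a colour `•`; Kato's pinned `I : Kato2004.IwasawaH1Data W p κ γ`;
"`L^∗_p(E, X)`" = `chromaticL • L♯ L♭` of any Sprung pair of `f` (`Sprung2017.IsSprungPair`, unique); "`X^∗(E/ℚ_∞)`"
= ANY `D : SharpFlatSelmerDualData W κ γ⁻¹ (closureEmb …) (a_p) g c •`, "`X⁰(E/K_∞)`" on the `Δ`-trivial component =
ANY `Y : W.FineSelmerDualData κ γ⁻¹` — the Pontryagin duals WITH THEIR CONTRAGREDIENT `Λ`-STRUCTURE (such data EXIST
at every key: `nonempty_sharpFlatSelmerDualData_rat`, or the twist `nonempty_sharpFlatSelmerDualData_of_mul_eq_one`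
of a key-`γ` datum); "`Char`" = `D.charIdeal`; "`⊇ (pⁿ L)`" = `(p : Λ)^n * L ∈ D.charIdeal`; surjectivity =
`W.HasSurjectiveModNGaloisRep (p^m)` for every `m`; in §2 the torsion-ness of `X^•` (print: Thm. 7.14 under the
same `L^• ≠ 0`) DISPLAYED as a hypothesis, WEAKER-by-binder, discharged by `.of_thm714`. NOT transcribed:
`η ≠ 1` (the `1/X` clause, the ideal `J`), Main Conj. 7.21 / [C] 7.15 / 7.20 (conjectures: Summits-side), Kato's
own formulation, `p = 2`.

## What is NOT here (and why)

* NO edit of any sibling; NO claim that `SharpFlatColemanKatoData` and `SharpFlatColemanKatoDataContra`, or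
  `thm716_…` and `thm716_…_contra`, are equivalent (they differ by unprinted `ι`-symmetries); NO conversion of the
  packages (the `γ ↦ γ⁻¹` twist re-keys `D`, `Y` — the proved dictionary —, not `colMap`).
* Everything the siblings list under «NOT here» (no Coleman map on local objects as a value statement, no
  Thm. 6.2/6.4, no Main Thm. 6.12 as a field, no `η ≠ 1`, no Main [C] 7.21); no `_holds` for the three facts
  (Kato §§8–13, Honda theory §2, Poitou–Tate along the tower: none in Mathlib; size XL).
-- TODO(general form): the `η ≠ 1` components and the `p = 2` analogue carry Poitou–Tate fields of the same
-- shape and deserve the same reading; not done here.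

## References
* [Sprung2012] J. Number Theory 132 (2012): §1 p. 1486 (Thm. 1.2, Thm. 1.4, "sending `γ` to `(1 + X)`");
  Thm. 2.2 (p. 1487); Def. 6.1 (p. 1495); Main Thm. 6.12, Prop. 6.14 (p. 1498); Def. 7.1, Prop. 7.3 (p. 1500);
  Prop. 7.6 (p. 1501); Def. 7.9, 7.11, 7.12 (p. 1503); Def. 7.13, Thm. 7.14 with (3), Thm. 7.16, Prop. 7.17,
  Thm. 7.18 (p. 1504); Prop. 7.19, Main Conj. 7.21 (p. 1505); clean glyphs arXiv:0903.3419v1 Thm. 57,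
  arXiv:1106.1936 Prop. 19.
* [Kato2004Asterisque] Astérisque 295 (2004): §12.2 (p. 220), Thm. 12.5/12.6 (p. 222), Ex. 13.3 (p. 225),
  §13.8 (p. 228), §14.9 (p. 239), §17.3 (p. 273), §17.13 (17.13.1) (p. 279). [Kobayashi2003] Invent. Math.
  152 (2003): Def. 2.1 (p. 5), Thm. 5.1 iii), 5.2 iv), Remark 5.3 i) (pp. 9–10), Prop. 7.1, (7.16)–(7.21),
  Thm. 7.3 i) (pp. 12–13), Prop. 8.25 (p. 25), Thm. 4.1. [Greenberg1989] Adv. Stud. Pure Math. 17, §0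
  pp. 101–102 (`S^ι`). [GreenbergLNM1716] §1 p. 60. [Washington1997] §13.2. [Sprung2017] ANT 11 (2017) Thm.
  1.12, Cor. 4.4–4.5. [LeiSujatha2021] Proc. AMS (2021) §1 (Sp).
* Tree: `Sprung2012/SharpFlatColemanKatoZeta.lean`, `SharpFlatColemanKatoZetaJoint.lean`,
  `SharpFlatKatoDivisibility.lean` (siblings), `Sprung2012/SharpFlatSelmer.lean`
  (`SharpFlatSelmerDualData.toDual_T_smul`), `Sprung2012/SharpFlatSelmerDualInvolutionTwistProofs.lean` (the
  dictionary), `KatoFineSelmerDual.lean`, `Kato2004/IwasawaCohomology(Coeff).lean` (`proj_T_smul`),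
  `Kobayashi2003/SignedColemanKatoZetaContragredient.lean` (the `a_p = 0` twin), `Kato2004/*Contragredient.lean`,
  `IwasawaAlgebraInvolution.lean` (`invol`).
* Cell documents: `run/shared/lean/pub/bsd-print-x8/ref/REF-G24-R250-KEYING-DECIDED.md` (§0 3(a)–(c), §1–§4,
  §7), `…/bsd-vet-x8-hg/VET-X8-HG-g0.md` (§5–§6), INPUTS desk
  `pub/bsd-wall/bsd-inputs/INPUTS-LIST-2-ADDENDUM-30.md` §A (F15 / F17 / F82); planner preview
  `…/bsd-print-x8-plan/hguard-W83-g32/c3prime/HGuardSketch3C.lean` §0 (`Thm716ContraStandIn` = §2's `def`,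
  verbatim); LEAD memo `Summits/…/Cruxes/SprungLowerDivisibilityAtThree/Lines/chromatic-common-zeros-KEYING-g5.md`.
-/

noncomputable section

open scoped MatrixGroups ModularForm NumberField

open CongruenceSubgroup WeierstrassCurve Field NumberField IsDedekindDomain
  Literature.NumberTheory.EllipticCurves Literature.NumberTheory.EllipticCurves.ModularForms
  Literature.NumberTheory.GaloisRepresentations Literature.NumberTheory.EllipticCurves.Kato2004
  Literature.NumberTheory.EllipticCurves.Kato2004.EulerSystemValues ZpExtension
  Literature.NumberTheory.EllipticCurves.Sprung2017 Literature.NumberTheory.EllipticCurves.IwasawaAlgebra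

namespace Literature.NumberTheory.EllipticCurves.Sprung2012

/-! ## §1 Def. 6.1 + Props. 7.3/7.6 + (3) of Thm. 7.14 at `η = 1`, with Kato's Thm. 12.6 zeta submodule —
the hypothesis structure with the PRINT-EXACT Poitou–Tate field, and its two construction facts -/

/-- **Sprung's Coleman / Poitou–Tate data for the colour `•` at the trivial character, with Kato's zeta
submodule, on pinned objects — PRINT-EXACT Poitou–Tate field.** VERBATIM the sibling
`SharpFlatColemanKatoData W p f ϖ κ γ ι a_p g c • I` (same parameters: globally minimal elliptic `W/ℚ`, `p`,
newform `f`, period ratio `ϖ` with `ϖ·Ω_E = Ω⁺_f`, cyclotomic `(κ, γ)`, the local data `(ι, a_p, g, c)` through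
which the tree defines `Ker Col^•` and `Sel^•`, colour `•`, Kato's pinned `I : Kato2004.IwasawaH1Data W p κ γ` with
`T = conj_γ − 1`, covariant, `1 + T ↦ γ`; same fields `colMap` («`ε_1 Col^• ∘ loc_p`» through Props. 7.3/7.6),
`colMap_injective` (when `L^•_p(E, X) ≠ 0`, Thm. 7.14's proof), `Z`, `zeta_le_span` (Kato Thm. 12.6 / Ex. 13.3),
`image_zeta_localized` (Def. 6.1 on ideals localized at each height-one prime, Néron normalisation via `G₁`)),
EXCEPT the field `exact` = (3) of Thm. 7.14's proof at `η = 1` with the Coleman isomorphism composed in, which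
here quantifies over the dual data with their CONTRAGREDIENT `Λ`-structure —
`D : SharpFlatSelmerDualData W κ γ⁻¹ ι a_p g c •` (`X^•(E/ℚ_∞)`, `T` acting as `x ↦ x ∘ conj_{γ⁻¹} − x`) and
`Y : W.FineSelmerDualData κ γ⁻¹` (`X₀(E/ℚ_∞)`, likewise) — the structure Poitou–Tate duality carries to the
natural action, for which the printed "exact sequence of `ℤ_p[[X]]`-modules" `𝐇¹ →^{colMap} Λ → X^• → X₀ → 0`
consists of `Λ`-LINEAR maps (flag `Sp12-714seq-dual-action`, module docstring; the sibling's `exact`, with `γ`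
there, is the printed sequence composed with `ι` out of `Λ`, i.e. it holds as printed iff `colMap(𝐇¹)` is
`ι`-symmetric — unprinted). Nothing asserted by the structure — existence is the named fact
`thm714seq_sharpFlatColemanKato_zeta_contra`.
[cite: Sprung2012, Def. 6.1 (p. 1495), Def. 7.1 and Prop. 7.3 (p. 1500), Prop. 7.6 (p. 1501), Def. 7.9, 7.11, 7.12 (p. 1503), Def. 7.13 and Thm. 7.14 with the exact sequence (3) of ℤ_p[[X]]-modules (p. 1504), Prop. 7.19 (p. 1505), Prop. 6.14 (p. 1498), §1 p. 1486 (γ ↦ 1 + X)]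
[cite: Kato2004Asterisque, Thm. 12.6 (p. 222), Ex. 13.3 (p. 225), §12.2 (p. 220), §13.8 (p. 228), §14.9 (p. 239) and §17.13 (p. 279)]
[cite: Kobayashi2003, Thm. 5.1 iii), Thm. 5.2 iv) and Remark 5.3 i) (pp. 9–10), Prop. 7.1 and (7.16)–(7.20) (p. 12), Thm. 7.3 i) (p. 13), Def. 2.1 (p. 5)]
[cite: Greenberg1989, §0 pp. 101–102 (the Λ-module S^ι, ι(γ) = γ⁻¹)] -/
structure SharpFlatColemanKatoDataContra (W : WeierstrassCurve ℚ) [W.IsElliptic] (p : ℕ) [Fact p.Prime]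
    [ContinuousSMul ℤ_[p] (W.tateModule p)] [Module.Free ℤ_[p] (W.tateModule p)]
    [Module.Finite ℤ_[p] (W.tateModule p)] {N : ℕ} (f : CuspForm (Gamma0 N) 2) (ϖ : ℚ)
    (κ : ZpExtension ℚ p) (γ : absoluteGaloisGroup ℚ)
    {E : Type} [Field E] [Algebra ℚ E] (ι : AlgebraicClosure ℚ →ₐ[ℚ] AlgebraicClosure E) (ap : ℤ)
    (g : absoluteGaloisGroup E) (c : ℕ → localPoints W E) (col : Chroma)
    (I : Kato2004.IwasawaH1Data W p κ γ) where
  /-- «`ε_1 Col^• ∘ loc_p`» on the `Δ`-trivial component: the arrow `ι` of (3) (colour `•`, `η = 1`)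
  composed with the isomorphism `H¹_Iw(T)^{η=1}/Ker ε_1 Col^• ≃ ℤ_p[[X]]` of Prop. 7.3 (`♭`) / Prop. 7.6
  (`♯`, `η = 1`) (as in the sibling). -/
  colMap : I.H →ₗ[IwasawaAlgebra p] IwasawaAlgebra p
  /-- Thm. 7.14, proof: `ι : 𝐇¹(T) → H¹_Iw(T)/Ker ε_1 Col^•` is injective when `L^•_p(E, X) ≠ 0` (as in the
  sibling). -/
  colMap_injective : ∀ (Lsharp Lflat : IwasawaAlgebra p), IsSprungPair f p ap Lsharp Lflat →
    chromaticL col Lsharp Lflat ≠ 0 → Function.Injective colMap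
  /-- Kato Thm. 12.6: the `Λ`-span `Z ⊂ 𝐇¹(T)` of the `p`-power lines of the integral zeta elements,
  projected to the `Δ`-trivial component `𝐇¹_Γ(T_pW)` (as in the sibling). -/
  Z : Submodule (IwasawaAlgebra p) I.H
  /-- Kato Thm. 12.6 with Ex. 13.3: `Z` lies in the span of GENUINE integral Euler-system classes (as in the
  sibling). -/
  zeta_le_span : Z ≤ Submodule.span (IwasawaAlgebra p) {s : I.H | Kato2004.IsEulerSystemClass W p κ γ I s}
  /-- Def. 6.1 (`η = 1`) with Def. 7.12 and Kato Thm. 12.6, read on IDEALS at every height-one prime: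
  `colMap(Z)` and `(G₁)`, `ι G₁ = C(ϖ)·ι(chromaticL • L♯ L♭)` for the tree's Sprung pair of `f`, agree after
  localisation at `𝔭` (as in the sibling — NO `ι`: `γ ↦ 1 + X` is Sprung's variable). -/
  image_zeta_localized : W.HasIrreducibleModPGaloisRep p →
    ∀ (Lsharp Lflat G₁ : IwasawaAlgebra p), IsSprungPair f p ap Lsharp Lflat →
      iwasawaToPowerSeries p G₁ =
        PowerSeries.C ((ϖ : ℚ) : ℚ_[p]) * iwasawaToPowerSeries p (chromaticL col Lsharp Lflat) →
      ∀ 𝔭 : PrimeSpectrum (IwasawaAlgebra p), 𝔭.asIdeal.height = 1 →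
        ∃ s : IwasawaAlgebra p, s ∉ 𝔭.asIdeal ∧
          s * G₁ ∈ Submodule.map colMap Z ∧
          ∀ z ∈ Z, s * colMap z ∈ Ideal.span {G₁}
  /-- (3) of Thm. 7.14's proof, colour `•`, `Δ`-trivial component, with Props. 7.3/7.6 composed in,
  PRINT-EXACT: for every dual datum `D` of `Sel^•(E/ℚ_∞)` and `Y` of `Sel₀(ℚ_∞, E[p^∞])` carrying the
  CONTRAGREDIENT `Λ`-structure (generator argument `γ⁻¹`: `T` acts as `x ↦ x ∘ conj_{γ⁻¹} − x`),
  `𝐇¹ →^{colMap} Λ → X^• → X₀ → 0` is exact for SOME `Λ`-linear `Λ → X^•`, `X^• → X₀`. -/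
  exact : ∀ (D : SharpFlatSelmerDualData W κ γ⁻¹ ι ap g c col) (Y : W.FineSelmerDualData κ γ⁻¹),
    ∃ (j : IwasawaAlgebra p →ₗ[IwasawaAlgebra p] D.X) (k : D.X →ₗ[IwasawaAlgebra p] Y.X),
      Function.Exact colMap j ∧ Function.Exact j k ∧ Function.Surjective k

/-- **Sprung 2012, Def. 6.1 + Props. 7.3/7.6 + Thm. 7.14's exact sequence (3) at the trivial character
(`ℚ_∞`), together with Kato 2004 Thm. 12.6 / Ex. 13.3, on pinned objects — PRINT-EXACT Poitou–Tate clause.**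
VERBATIM the sibling `thm714seq_sharpFlatColemanKato_zeta` (same binders: globally minimal `W/ℚ`, the structure
facts of `T_pW` as instance BINDERS, ODD prime `p` of good reduction with `p ∣ a_p` — ANY supersingular `a_p`,
in particular `(3, ±3)` —, newform `f` of `W` with period ratio `ϖ` (`ϖ·Ω_E = Ω⁺_f`), cyclotomic `(κ, γ)`
matching the cyclotomic variable, the place `v ∣ p` with a local lift `g` of `γ` and a Honda system `(cneg, c)`
(Thm. 2.2), every colour `•` and every pinned `I : Kato2004.IwasawaH1Data W p κ γ`) with conclusion
`Nonempty (SharpFlatColemanKatoDataContra … • I)` instead of `Nonempty (SharpFlatColemanKatoData …)`: the data are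
inhabited by `ε_1 Col^• ∘ loc_p` with Props. 7.3/7.6, Kato's Thm. 12.6 submodule, Def. 6.1 on localized ideals,
and the `Δ`-trivial component of (3) — the last for the Pontryagin duals with their contragredient
`Λ`-structure (generator argument `γ⁻¹`), for which the printed maps are `Λ`-linear (flag
`Sp12-714seq-dual-action`; the sibling, with `γ` there, is the printed (3) composed with `ι` out of `Λ`,
equal to the print only if `colMap(𝐇¹)` is `ι`-symmetric — unprinted). A CONSTRUCTION fact, weaker than print
(maps existential, `Z` only bounded above), never stronger; nothing asserted; no `_holds` (size XL); all the
sibling's reading flags apply verbatim. The print-keyed successor of route item stmt-BirchSwinnertonDyer-20772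
`InputSharpFlatColemanKatoZeta` once the planner re-binds it.
[cite: Sprung2012, Def. 6.1 (p. 1495), Prop. 7.3 (p. 1500), Prop. 7.6 (p. 1501), Def. 7.9, 7.11, 7.12 (p. 1503), Def. 7.13, Thm. 7.14 with (3) (p. 1504), Prop. 7.19 (p. 1505), Main Thm. 6.12 and Prop. 6.14 (p. 1498), Thm. 2.2 (p. 1487), §1 p. 1486]
[cite: Kato2004Asterisque, Thm. 12.5 and Thm. 12.6 (p. 222), Ex. 13.3 (p. 225), §12.2 (p. 220), §13.8 (p. 228), §14.9 (p. 239), §17.13 (p. 279)]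
[cite: Kobayashi2003, Thm. 5.1 iii), Thm. 5.2 i)/iv) and Remark 5.3 i) (pp. 9–10), Prop. 7.1 and (7.16)–(7.20) (p. 12), Thm. 7.3 i) (p. 13), Prop. 8.25 (p. 25), Def. 2.1 (p. 5)]
[cite: Sprung2017, Thm. 1.12 and Cor. 4.4–4.5 (the pair characterised by the Mazur–Tate congruences)]
[cite: Greenberg1989, §0 pp. 101–102 (the Λ-module S^ι)] -/
def thm714seq_sharpFlatColemanKato_zeta_contra : Prop :=
  ∀ (W : WeierstrassCurve ℚ) [W.IsElliptic] [W.IsGloballyMinimal] (p : ℕ) [Fact p.Prime]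
    [ContinuousSMul ℤ_[p] (W.tateModule p)] [Module.Free ℤ_[p] (W.tateModule p)]
    [Module.Finite ℤ_[p] (W.tateModule p)] {N : ℕ} [NeZero N] (f : CuspForm (Gamma0 N) 2) (ϖ : ℚ)
    (κ : ZpExtension ℚ p) (γ : absoluteGaloisGroup ℚ),
    p ≠ 2 → W.HasGoodReductionAtPrime p → (p : ℤ) ∣ W.frobeniusTrace p → IsNewformOf W f →
    (ϖ : ℝ) * W.realPeriodRat = plusPeriod f →
    κ.IsCyclotomic → κ.IsTopGenerator γ → IsCyclotomicVariable p γ →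
    ∀ (v : HeightOneSpectrum (𝓞 ℚ)), (p : 𝓞 ℚ) ∈ v.asIdeal →
    ∀ (g : absoluteGaloisGroup (v.adicCompletion ℚ)),
      κ.IsTopGenerator (resGalOfEmb (closureEmb (K := ℚ) (v.adicCompletion ℚ)) g) →
    ∀ (cneg : localPoints W (v.adicCompletion ℚ)) (c : ℕ → localPoints W (v.adicCompletion ℚ)),
      IsHondaSystem κ (closureEmb (K := ℚ) (v.adicCompletion ℚ)) W (W.frobeniusTrace p) g cneg c →
    ∀ (col : Chroma) (I : Kato2004.IwasawaH1Data W p κ γ),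
      Nonempty (SharpFlatColemanKatoDataContra W p f ϖ κ γ (closureEmb (K := ℚ) (v.adicCompletion ℚ))
        (W.frobeniusTrace p) g c col I)

/-- **Sprung 2012, Def. 7.12 / Thm. 7.14 (3) / Prop. 7.19 (with Def. 6.1, Props. 7.3/7.6, Kato 2004 Thm.
12.5/12.6) — the JOINT ♯/♭ Coleman–Kato package on ONE zeta submodule, PRINT-EXACT Poitou–Tate clause**
(construction fact, `Prop`; UNPROVED in Lean; published theorem). VERBATIM the sibling
`thm714seq_sharpFlatColemanKato_zetaJoint` (same binder telescope, letter for letter) with the two packages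
`Cs : SharpFlatColemanKatoDataContra … Chroma.sharp I`, `Cf : SharpFlatColemanKatoDataContra … Chroma.flat I` —
Coleman map `ε_1 Col^• ∘ loc_p`, injective when `L^• ≠ 0`; zeta submodule `Z ⊂ 𝐇¹(T)` inside the span of genuine
Euler-system classes; `Col^•(Z) = (ϖ·L^•_p(E))` on ideals localized at each height-one prime; the `Δ`-trivial
component of (3) for every dual datum WITH ITS CONTRAGREDIENT `Λ`-STRUCTURE (generator argument `γ⁻¹`) — on THE
SAME ZETA SUBMODULE, `Cs.Z = Cf.Z`: in print `𝐙(T)` (Def. 7.12) is defined with no reference to the colour and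
both sequences of Prop. 7.19 start at `𝐇¹(T)^η/𝐙(T)^η`. The only content beyond
`thm714seq_sharpFlatColemanKato_zeta_contra` (implied back by `thm714seq_sharpFlatColemanKato_zeta_contra_of_joint`,
PROVED) is that shared `Z`. The print-keyed successor of conjunct (iii) `hJ` of route item
stmt-BirchSwinnertonDyer-22571 `HeldInputsX8R` and of the `I, Cs, Cf, Cs.Z = Cf.Z` binders of the
`SprungLowerDivisibilityAtThree` children, once the planner re-binds them.
[cite: Sprung2012, Def. 6.1 (p. 1495), Prop. 7.3 (p. 1500), Prop. 7.6 (p. 1501), Def. 7.12 (p. 1503), Thm. 7.14 with (3) (p. 1504), Prop. 7.19 (p. 1505), Thm. 2.2 (p. 1487)]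
[cite: Kato2004Asterisque, Thm. 12.5 and Thm. 12.6 (p. 222), Ex. 13.3 (p. 225), §12.2 (p. 220), §17.13 (p. 279)]
[cite: Kobayashi2003, Thm. 5.1 iii), Thm. 5.2 iv), Remark 5.3 i) (pp. 9–10), Thm. 7.3 i) (p. 13)]
[cite: Greenberg1989, §0 pp. 101–102 (the Λ-module S^ι)] -/
def thm714seq_sharpFlatColemanKato_zetaJoint_contra : Prop :=
  ∀ (W : WeierstrassCurve ℚ) [W.IsElliptic] [W.IsGloballyMinimal] (p : ℕ) [Fact p.Prime]
    [ContinuousSMul ℤ_[p] (W.tateModule p)] [Module.Free ℤ_[p] (W.tateModule p)]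
    [Module.Finite ℤ_[p] (W.tateModule p)] {N : ℕ} [NeZero N] (f : CuspForm (Gamma0 N) 2) (ϖ : ℚ)
    (κ : ZpExtension ℚ p) (γ : absoluteGaloisGroup ℚ),
    p ≠ 2 → W.HasGoodReductionAtPrime p → (p : ℤ) ∣ W.frobeniusTrace p → IsNewformOf W f →
    (ϖ : ℝ) * W.realPeriodRat = plusPeriod f →
    κ.IsCyclotomic → κ.IsTopGenerator γ → IsCyclotomicVariable p γ →
    ∀ (v : HeightOneSpectrum (𝓞 ℚ)), (p : 𝓞 ℚ) ∈ v.asIdeal →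
    ∀ (g : absoluteGaloisGroup (v.adicCompletion ℚ)),
      κ.IsTopGenerator (resGalOfEmb (closureEmb (K := ℚ) (v.adicCompletion ℚ)) g) →
    ∀ (cneg : localPoints W (v.adicCompletion ℚ)) (c : ℕ → localPoints W (v.adicCompletion ℚ)),
      IsHondaSystem κ (closureEmb (K := ℚ) (v.adicCompletion ℚ)) W (W.frobeniusTrace p) g cneg c →
    ∀ (I : Kato2004.IwasawaH1Data W p κ γ),
      ∃ (Cs : SharpFlatColemanKatoDataContra W p f ϖ κ γ (closureEmb (K := ℚ) (v.adicCompletion ℚ))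
            (W.frobeniusTrace p) g c Chroma.sharp I)
        (Cf : SharpFlatColemanKatoDataContra W p f ϖ κ γ (closureEmb (K := ℚ) (v.adicCompletion ℚ))
            (W.frobeniusTrace p) g c Chroma.flat I),
        Cs.Z = Cf.Z

/-- **Projection to the one-colour fact** (PROVED): the joint print-keyed package gives, colour by colour, an
inhabitant of `SharpFlatColemanKatoDataContra … • I` — i.e. `thm714seq_sharpFlatColemanKato_zeta_contra` follows from
the joint reading by forgetting `Cs.Z = Cf.Z` (the sibling's `thm714seq_sharpFlatColemanKato_zeta_of_joint`, token
for token). [cite: Sprung2012, Def. 7.12 (p. 1503), Thm. 7.14 with (3) (p. 1504), Prop. 7.19 (p. 1505)] -/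
theorem thm714seq_sharpFlatColemanKato_zeta_contra_of_joint
    (h : thm714seq_sharpFlatColemanKato_zetaJoint_contra) : thm714seq_sharpFlatColemanKato_zeta_contra := by
  intro W _ _ p _ _ _ _ N _ f ϖ κ γ hp hgood hap hf hϖ hκ hγ hcv v hv g hg cneg c hH col I
  obtain ⟨Cs, Cf, _⟩ := h W p f ϖ κ γ hp hgood hap hf hϖ hκ hγ hcv v hv g hg cneg c hH I
  cases col with
  | sharp => exact ⟨Cs⟩
  | flat => exact ⟨Cf⟩

/-! ## §2 Theorem 7.16 (`η = 1`) / Theorem 1.4 — the Kato-side inclusion for `X^•` with its contragredient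
(print) `Λ`-structure, and its proved one-line consequences -/

/-- **Sprung 2012, Theorem 7.16 at the trivial tame character (its `n = 0` clause is Theorem 1.4), for the
Pontryagin dual `X^•(E/ℚ_∞)` with its CONTRAGREDIENT `Λ`-structure — the PRINT-EXACT keying: the Kato-side
inclusion `Char X^•(E/ℚ_∞) ⊇ (pⁿ L^•_p(E, X))`** (a THEOREM of the source, from Kato's Euler system — Thm.
7.18 = [Ka, Thm. 12.5] — through Kurihara's Prop. 7.17 and the Poitou–Tate exact sequences of Prop. 7.19).
Printed (p. 1504): "Let `p` be an odd supersingular prime, and `∗ ∈ {♯, ♭}` so that `L^∗_p(E, η, X) ≠ 0`. Then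
for some integer `n ⩾ 0`, … `Char X^∗(E/K_∞)^η ⊇ (pⁿ L^∗_p(E, η, X))` for all other cases [than `∗ = ♯`,
`η ≠ 1`, `a_p = 0`]. Further, if the `p`-adic representation `Gal(ℚ̄/ℚ) → GL_{ℤ_p}(T)` on the automorphism
group of the `p`-adic Tate module `T` is surjective, we can take `n = 0`." — and p. 1486, Theorem 1.4: "…
Then if the `p`-adic representation … is surjective, we have `Char(X^∗(E/ℚ_∞)) ⊇ (L^∗_p(E, X))`."
TRANSCRIBED exactly as the sibling `thm716_sharpFlatCharIdeal_divisibility` (module docstrings "Transcription"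
there and here) — same setting (`W/ℚ` globally minimal, `p ≠ 2` good with `p ∣ a_p`, newform `f`, cyclotomic
`(κ, γ)` with `IsCyclotomicVariable p γ`, the place `v ∣ p`, local lift `g`, Honda system `(cneg, c)`), same
colour `•` and Sprung pair `(L♯, L♭)` with `L^• = chromaticL • L♯ L♭ ≠ 0`, same displayed torsion hypotheses,
same two clauses (a) `pⁿ · L^• ∈ Char(X^•)` for some `n ≥ 0`, (b) `L^• ∈ Char(X^•)` if `ρ_{E,p^∞}` is
surjective — with the ONE change that the dual datum is keyed by `γ⁻¹`:
`D : SharpFlatSelmerDualData W κ γ⁻¹ (closureEmb …) (a_p) g c •`, i.e. `T` acts on `X^• = Hom(Sel^•, ℚ/ℤ)` as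
`x ↦ x ∘ conj_{γ⁻¹} − x`, the CONTRAGREDIENT structure that Poitou–Tate duality ((3) of Thm. 7.14, Prop. 7.19:
"exact sequence of `ℤ_p[[X]]`-modules") carries to the natural action on `𝐇¹(T)` / `H¹_Iw(T)`, on which
`Col^•` and `L^•_p(E, X)` are defined with `γ ↦ 1 + X` (flag `Sp12-716-dual-action`, module docstring; the
sibling, keyed by `γ`, speaks of the twist `(X^•)^ι` and says «`pⁿ·ι(L^•) ∈ Char X^•`» instead — see
`.invol_rational`). Period normalisation: flag `Sp12-716-period` of the sibling, verbatim. The `η ≠ 1`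
components, the converse inclusion (Main Conj. 1.3 / 7.21) and Kato's own formulation are NOT asserted.
Nothing is asserted: users take `(h : thm716_sharpFlatCharIdeal_divisibility_contra)`; no `_holds` is expected
(Kato §§8–13, Honda theory, Poitou–Tate along the tower: none in Mathlib; size XL). This `def` is, token for
token, the planner's elaboration stand-in `Thm716ContraStandIn` (cell document `c3prime/HGuardSketch3C.lean` §0).
[cite: Sprung2012, Thm. 7.16 (p. 1504) and Thm. 1.4 (p. 1486); Def. 7.11 (p. 1503); Thm. 7.14 with the exact sequence (3) of ℤ_p[[X]]-modules (p. 1504); Prop. 7.19 (p. 1505); §1 p. 1486 (γ ↦ 1 + X); corpus `paper:doi-10-1016-j-jnt-2011-11-003` p0022 L40–L71, p0023 L5–L19, p0004 L46–L57]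
[cite: Kato2004Asterisque, §12.2 (p. 220), Thm. 12.5 (p. 222) and §17.13 (17.13.1) (p. 279) (the natural Λ-structure on Iwasawa cohomology; "a sequence of Λ-modules")]
[cite: Greenberg1989, §0 pp. 101–102 (the Λ-module S^ι, ι(γ) = γ⁻¹)]
[cite: LeiSujatha2021, §1 (Sp) and the sentence on Kato's inclusion with `n = 0`] -/
def thm716_sharpFlatCharIdeal_divisibility_contra : Prop :=
  ∀ (W : WeierstrassCurve ℚ) [W.IsElliptic] [W.IsGloballyMinimal] (p : ℕ) [Fact p.Prime],
    p ≠ 2 → W.HasGoodReductionAtPrime p → (p : ℤ) ∣ W.frobeniusTrace p →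
    ∀ {N : ℕ} [NeZero N] (f : CuspForm (Gamma0 N) 2), IsNewformOf W f →
    ∀ (κ : ZpExtension ℚ p) (γ : Field.absoluteGaloisGroup ℚ),
      κ.IsCyclotomic → κ.IsTopGenerator γ → IsCyclotomicVariable p γ →
    ∀ (v : HeightOneSpectrum (𝓞 ℚ)), (p : 𝓞 ℚ) ∈ v.asIdeal →
    ∀ (g : Field.absoluteGaloisGroup (v.adicCompletion ℚ)),
      κ.IsTopGenerator (resGalOfEmb (closureEmb (K := ℚ) (v.adicCompletion ℚ)) g) →
    ∀ (cneg : localPoints W (v.adicCompletion ℚ)) (c : ℕ → localPoints W (v.adicCompletion ℚ)),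
      IsHondaSystem κ (closureEmb (K := ℚ) (v.adicCompletion ℚ)) W (W.frobeniusTrace p) g cneg c →
    ∀ (col : Chroma) (Lsharp Lflat : IwasawaAlgebra p),
      IsSprungPair f p (W.frobeniusTrace p) Lsharp Lflat → chromaticL col Lsharp Lflat ≠ 0 →
    ∀ (D : SharpFlatSelmerDualData W κ γ⁻¹ (closureEmb (K := ℚ) (v.adicCompletion ℚ))
        (W.frobeniusTrace p) g c col) [Module.Finite (IwasawaAlgebra p) D.X],
      Module.IsTorsion (IwasawaAlgebra p) D.X →
      (∃ n : ℕ, (p : IwasawaAlgebra p) ^ n * chromaticL col Lsharp Lflat ∈ D.charIdeal) ∧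
      ((∀ m : ℕ, W.HasSurjectiveModNGaloisRep (p ^ m : ℕ)) →
        chromaticL col Lsharp Lflat ∈ D.charIdeal)

namespace thm716_sharpFlatCharIdeal_divisibility_contra

variable {W : WeierstrassCurve ℚ} [W.IsElliptic] [W.IsGloballyMinimal] {p : ℕ} [Fact p.Prime]
  {N : ℕ} [NeZero N] {f : CuspForm (Gamma0 N) 2}
  {κ : ZpExtension ℚ p} {γ : Field.absoluteGaloisGroup ℚ} {v : HeightOneSpectrum (𝓞 ℚ)}
  {g : Field.absoluteGaloisGroup (v.adicCompletion ℚ)}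
  {cneg : localPoints W (v.adicCompletion ℚ)} {c : ℕ → localPoints W (v.adicCompletion ℚ)}
  {col : Chroma} {Lsharp Lflat : IwasawaAlgebra p}

/-- Thm. 7.16, first display at `η = 1` (print keying), as a function of the fact: **`pⁿ L^•_p(E, X) ∈ Char(X^•)`
for some `n ≥ 0`** (no hypothesis on the Galois image). [cite: Sprung2012, Thm. 7.16 (p. 1504)] -/
theorem rational (h : thm716_sharpFlatCharIdeal_divisibility_contra) (hp : p ≠ 2)
    (hgood : W.HasGoodReductionAtPrime p) (hss : (p : ℤ) ∣ W.frobeniusTrace p) (hf : IsNewformOf W f)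
    (hκ : κ.IsCyclotomic) (hγ : κ.IsTopGenerator γ) (hγ' : IsCyclotomicVariable p γ)
    (hv : (p : 𝓞 ℚ) ∈ v.asIdeal)
    (hg : κ.IsTopGenerator (resGalOfEmb (closureEmb (K := ℚ) (v.adicCompletion ℚ)) g))
    (hH : IsHondaSystem κ (closureEmb (K := ℚ) (v.adicCompletion ℚ)) W (W.frobeniusTrace p) g cneg c)
    (hL : IsSprungPair f p (W.frobeniusTrace p) Lsharp Lflat) (hL0 : chromaticL col Lsharp Lflat ≠ 0)
    (D : SharpFlatSelmerDualData W κ γ⁻¹ (closureEmb (K := ℚ) (v.adicCompletion ℚ))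
      (W.frobeniusTrace p) g c col) [Module.Finite (IwasawaAlgebra p) D.X]
    (hX : Module.IsTorsion (IwasawaAlgebra p) D.X) :
    ∃ n : ℕ, (p : IwasawaAlgebra p) ^ n * chromaticL col Lsharp Lflat ∈ D.charIdeal :=
  (h W p hp hgood hss f hf κ γ hκ hγ hγ' v hv g hg cneg c hH col Lsharp Lflat hL hL0 D hX).1

/-- Thm. 7.16, last sentence (= Thm. 1.4), print keying, as a function of the fact: **if `ρ_{E,p^∞}` is
surjective then `L^•_p(E, X) ∈ Char(X^•)`** ("we can take `n = 0`").
[cite: Sprung2012, Thm. 1.4 (p. 1486) and Thm. 7.16 (p. 1504)] -/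
theorem integral (h : thm716_sharpFlatCharIdeal_divisibility_contra) (hp : p ≠ 2)
    (hgood : W.HasGoodReductionAtPrime p) (hss : (p : ℤ) ∣ W.frobeniusTrace p) (hf : IsNewformOf W f)
    (hκ : κ.IsCyclotomic) (hγ : κ.IsTopGenerator γ) (hγ' : IsCyclotomicVariable p γ)
    (hv : (p : 𝓞 ℚ) ∈ v.asIdeal)
    (hg : κ.IsTopGenerator (resGalOfEmb (closureEmb (K := ℚ) (v.adicCompletion ℚ)) g))
    (hH : IsHondaSystem κ (closureEmb (K := ℚ) (v.adicCompletion ℚ)) W (W.frobeniusTrace p) g cneg c)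
    (hL : IsSprungPair f p (W.frobeniusTrace p) Lsharp Lflat) (hL0 : chromaticL col Lsharp Lflat ≠ 0)
    (D : SharpFlatSelmerDualData W κ γ⁻¹ (closureEmb (K := ℚ) (v.adicCompletion ℚ))
      (W.frobeniusTrace p) g c col) [Module.Finite (IwasawaAlgebra p) D.X]
    (hX : Module.IsTorsion (IwasawaAlgebra p) D.X)
    (hsurj : ∀ m : ℕ, W.HasSurjectiveModNGaloisRep (p ^ m : ℕ)) :
    chromaticL col Lsharp Lflat ∈ D.charIdeal :=
  (h W p hp hgood hss f hf κ γ hκ hγ hγ' v hv g hg cneg c hH col Lsharp Lflat hL hL0 D hX).2 hsurj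

/-- **(MC↑•) in the route's binder shape, print keying.** For a characteristic power series `ξ^•` of
`X^•(E/ℚ_∞)` (`Char(X^•) = (ξ^•)`) and `ρ_{E,p^∞}` surjective: **`ξ^• ∣ L^•_p(E, X)` in `Λ`**
(`Ideal.mem_span_singleton`). [cite: Sprung2012, Thm. 7.16 (p. 1504)] -/
theorem dvd_of_charIdeal_eq_span (h : thm716_sharpFlatCharIdeal_divisibility_contra) (hp : p ≠ 2)
    (hgood : W.HasGoodReductionAtPrime p) (hss : (p : ℤ) ∣ W.frobeniusTrace p) (hf : IsNewformOf W f)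
    (hκ : κ.IsCyclotomic) (hγ : κ.IsTopGenerator γ) (hγ' : IsCyclotomicVariable p γ)
    (hv : (p : 𝓞 ℚ) ∈ v.asIdeal)
    (hg : κ.IsTopGenerator (resGalOfEmb (closureEmb (K := ℚ) (v.adicCompletion ℚ)) g))
    (hH : IsHondaSystem κ (closureEmb (K := ℚ) (v.adicCompletion ℚ)) W (W.frobeniusTrace p) g cneg c)
    (hL : IsSprungPair f p (W.frobeniusTrace p) Lsharp Lflat) (hL0 : chromaticL col Lsharp Lflat ≠ 0)
    (D : SharpFlatSelmerDualData W κ γ⁻¹ (closureEmb (K := ℚ) (v.adicCompletion ℚ))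
      (W.frobeniusTrace p) g c col) [Module.Finite (IwasawaAlgebra p) D.X]
    (hX : Module.IsTorsion (IwasawaAlgebra p) D.X)
    (hsurj : ∀ m : ℕ, W.HasSurjectiveModNGaloisRep (p ^ m : ℕ))
    {ξ : IwasawaAlgebra p} (hξ : D.charIdeal = Ideal.span {ξ}) : ξ ∣ chromaticL col Lsharp Lflat := by
  have hmem := integral h hp hgood hss hf hκ hγ hγ' hv hg hH hL hL0 D hX hsurj
  rw [hξ] at hmem
  exact Ideal.mem_span_singleton.mp hmem

/-- The rational form in the binder shape, print keying: for `Char(X^•) = (ξ^•)`, **`ξ^• ∣ pⁿ L^•_p(E, X)` for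
some `n ≥ 0`**, with no hypothesis on the Galois image. [cite: Sprung2012, Thm. 7.16 (p. 1504)] -/
theorem exists_dvd_pow_mul (h : thm716_sharpFlatCharIdeal_divisibility_contra) (hp : p ≠ 2)
    (hgood : W.HasGoodReductionAtPrime p) (hss : (p : ℤ) ∣ W.frobeniusTrace p) (hf : IsNewformOf W f)
    (hκ : κ.IsCyclotomic) (hγ : κ.IsTopGenerator γ) (hγ' : IsCyclotomicVariable p γ)
    (hv : (p : 𝓞 ℚ) ∈ v.asIdeal)
    (hg : κ.IsTopGenerator (resGalOfEmb (closureEmb (K := ℚ) (v.adicCompletion ℚ)) g))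
    (hH : IsHondaSystem κ (closureEmb (K := ℚ) (v.adicCompletion ℚ)) W (W.frobeniusTrace p) g cneg c)
    (hL : IsSprungPair f p (W.frobeniusTrace p) Lsharp Lflat) (hL0 : chromaticL col Lsharp Lflat ≠ 0)
    (D : SharpFlatSelmerDualData W κ γ⁻¹ (closureEmb (K := ℚ) (v.adicCompletion ℚ))
      (W.frobeniusTrace p) g c col) [Module.Finite (IwasawaAlgebra p) D.X]
    (hX : Module.IsTorsion (IwasawaAlgebra p) D.X)
    {ξ : IwasawaAlgebra p} (hξ : D.charIdeal = Ideal.span {ξ}) :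
    ∃ n : ℕ, ξ ∣ (p : IwasawaAlgebra p) ^ n * chromaticL col Lsharp Lflat := by
  obtain ⟨n, hmem⟩ := rational h hp hgood hss hf hκ hγ hγ' hv hg hH hL hL0 D hX
  rw [hξ] at hmem
  exact ⟨n, Ideal.mem_span_singleton.mp hmem⟩

/-- **Thm. 7.16 (print keying) with the torsion hypotheses discharged by Thm. 7.14** — the KEYING-IMMUNE
sibling fact `thm714_sharpFlatSelmerDual_finite_torsion` (stated for key-`γ` data) transported through the
PROVED `ι`-dictionary (`sharpFlatSelmerDualData_finite_inv_iff`, `sharpFlatSelmerDualData_isTorsion_inv_iff`: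
finite generation and `Λ`-torsionness of `X^•` do not depend on the key): for the colour `•` with `L^• ≠ 0` and
ANY contragredient datum `D` of `Sel^•(E/ℚ_∞)`, (a) `pⁿ L^• ∈ Char(X^•)` for some `n`, and (b)
`L^• ∈ Char(X^•)` under surjectivity of `ρ_{E,p^∞}` — the printed form of Thm. 7.16 / 1.4 (hypothesis
`L^∗_p ≠ 0` alone). This is the bridge the held pack «`thm714 ∧ thm716_contra ∧ period`» of the cell's planner
needs; no `thm714` twin is required.
[cite: Sprung2012, Thm. 1.2 and Thm. 1.4 (p. 1486), Thm. 7.14 and Thm. 7.16 (p. 1504)]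
[cite: GreenbergLNM1716, §1 (p. 60)] -/
theorem of_thm714 (h : thm716_sharpFlatCharIdeal_divisibility_contra)
    (h714 : thm714_sharpFlatSelmerDual_finite_torsion) (hp : p ≠ 2)
    (hgood : W.HasGoodReductionAtPrime p) (hss : (p : ℤ) ∣ W.frobeniusTrace p) (hf : IsNewformOf W f)
    (hκ : κ.IsCyclotomic) (hγ : κ.IsTopGenerator γ) (hγ' : IsCyclotomicVariable p γ)
    (hv : (p : 𝓞 ℚ) ∈ v.asIdeal)
    (hg : κ.IsTopGenerator (resGalOfEmb (closureEmb (K := ℚ) (v.adicCompletion ℚ)) g))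
    (hH : IsHondaSystem κ (closureEmb (K := ℚ) (v.adicCompletion ℚ)) W (W.frobeniusTrace p) g cneg c)
    (hL : IsSprungPair f p (W.frobeniusTrace p) Lsharp Lflat) (hL0 : chromaticL col Lsharp Lflat ≠ 0)
    (D : SharpFlatSelmerDualData W κ γ⁻¹ (closureEmb (K := ℚ) (v.adicCompletion ℚ))
      (W.frobeniusTrace p) g c col) :
    (∃ n : ℕ, (p : IwasawaAlgebra p) ^ n * chromaticL col Lsharp Lflat ∈ D.charIdeal) ∧
      ((∀ m : ℕ, W.HasSurjectiveModNGaloisRep (p ^ m : ℕ)) →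
        chromaticL col Lsharp Lflat ∈ D.charIdeal) := by
  obtain ⟨D₀⟩ := nonempty_sharpFlatSelmerDualData_rat W κ γ v g c col
  haveI : Module.Finite (IwasawaAlgebra p) D₀.X :=
    h714.moduleFinite hp hgood hss hf hκ hγ hγ' hv hg hH hL hL0 D₀
  have hX₀ : Module.IsTorsion (IwasawaAlgebra p) D₀.X :=
    h714.isTorsion hp hgood hss hf hκ hγ hγ' hv hg hH hL hL0 D₀
  haveI : Module.Finite (IwasawaAlgebra p) D.X := (sharpFlatSelmerDualData_finite_inv_iff D₀ D).1 ‹_›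
  have hX : Module.IsTorsion (IwasawaAlgebra p) D.X := (sharpFlatSelmerDualData_isTorsion_inv_iff D₀ D).1 hX₀
  exact h W p hp hgood hss f hf κ γ hκ hγ hγ' v hv g hg cneg c hH col Lsharp Lflat hL hL0 D hX

/-- **Non-vacuity** (the fact and Thm. 7.14 granted): for a colour `•` with `L^• ≠ 0` there ARE a contragredient
dual datum `D` of `Sel^•(E/ℚ_∞)` (`nonempty_sharpFlatSelmerDualData_rat` at the key `γ⁻¹`, a CONSTRUCTION), a
characteristic power series `ξ^•` (`Char(X^•)` is principal: `charIdeal_isPrincipal_holds`, `Λ` a UFD) and an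
`n ≥ 0` with `ξ^• ∣ pⁿ L^•` in `Λ` — an actual instance of the displayed upper divisibility, on Sprung's own
`X^•` in print keying. [cite: Sprung2012, Thm. 1.2 and Thm. 1.4 (p. 1486), Thm. 7.16 (p. 1504)] -/
theorem exists_datum_dvd (h : thm716_sharpFlatCharIdeal_divisibility_contra)
    (h714 : thm714_sharpFlatSelmerDual_finite_torsion) (hp : p ≠ 2)
    (hgood : W.HasGoodReductionAtPrime p) (hss : (p : ℤ) ∣ W.frobeniusTrace p) (hf : IsNewformOf W f)
    (hκ : κ.IsCyclotomic) (hγ : κ.IsTopGenerator γ) (hγ' : IsCyclotomicVariable p γ)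
    (hv : (p : 𝓞 ℚ) ∈ v.asIdeal)
    (hg : κ.IsTopGenerator (resGalOfEmb (closureEmb (K := ℚ) (v.adicCompletion ℚ)) g))
    (hH : IsHondaSystem κ (closureEmb (K := ℚ) (v.adicCompletion ℚ)) W (W.frobeniusTrace p) g cneg c)
    (hL : IsSprungPair f p (W.frobeniusTrace p) Lsharp Lflat) (hL0 : chromaticL col Lsharp Lflat ≠ 0) :
    ∃ (D : SharpFlatSelmerDualData W κ γ⁻¹ (closureEmb (K := ℚ) (v.adicCompletion ℚ))
        (W.frobeniusTrace p) g c col) (ξ : IwasawaAlgebra p) (n : ℕ),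
      D.charIdeal = Ideal.span {ξ} ∧ ξ ∣ (p : IwasawaAlgebra p) ^ n * chromaticL col Lsharp Lflat := by
  obtain ⟨D⟩ := nonempty_sharpFlatSelmerDualData_rat W κ γ⁻¹ v g c col
  obtain ⟨D₀⟩ := nonempty_sharpFlatSelmerDualData_rat W κ γ v g c col
  haveI : Module.Finite (IwasawaAlgebra p) D₀.X :=
    h714.moduleFinite hp hgood hss hf hκ hγ hγ' hv hg hH hL hL0 D₀
  have hX₀ : Module.IsTorsion (IwasawaAlgebra p) D₀.X :=
    h714.isTorsion hp hgood hss hf hκ hγ hγ' hv hg hH hL hL0 D₀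
  haveI : Module.Finite (IwasawaAlgebra p) D.X := (sharpFlatSelmerDualData_finite_inv_iff D₀ D).1 ‹_›
  have hX : Module.IsTorsion (IwasawaAlgebra p) D.X := (sharpFlatSelmerDualData_isTorsion_inv_iff D₀ D).1 hX₀
  obtain ⟨ξ, hξ⟩ := (charIdeal_isPrincipal_holds p D.X).principal
  have hξ' : D.charIdeal = Ideal.span {ξ} := hξ
  obtain ⟨n, hn⟩ := exists_dvd_pow_mul h hp hgood hss hf hκ hγ hγ' hv hg hH hL hL0 D hX hξ'
  exact ⟨D, ξ, n, hξ', hn⟩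

/-- **The fact READ ON A TREE-KEYED datum** (key `γ`: `T` acts as `x ↦ x ∘ conj_γ − x`, i.e. the twist
`(X^•)^ι` of print's `X^•`): for every such `D₀` with `D₀.X` finitely generated `Λ`-torsion, **`pⁿ · ι(L^•_p(E, X))
∈ char(D₀.X)` for some `n ≥ 0`**, where `ι` is the Iwasawa involution `T ↦ (1 + T)⁻¹ − 1`
(`IwasawaAlgebra.invol`; `ι` fixes `p`). This is Thm. 7.16 transported through the PROVED dictionary
`sharpFlatSelmerDualData_mem_charIdeal_inv_iff` (`f ∈ char D.X ↔ ι f ∈ char D₀.X` for `D` of key `γ⁻¹`) — the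
`ι`-form («C″» of the cell's keying memo) for consumers whose ♯/♭ dual binders stay key-`γ`; it is what print
gives for the sibling's datum, in place of the sibling's «`pⁿ·L^• ∈ char D₀.X`».
[cite: Sprung2012, Thm. 7.16 (p. 1504)] [cite: Greenberg1989, §0 pp. 101–102 (S^ι)] [cite: Washington1997, §13.2] -/
theorem invol_rational (h : thm716_sharpFlatCharIdeal_divisibility_contra) (hp : p ≠ 2)
    (hgood : W.HasGoodReductionAtPrime p) (hss : (p : ℤ) ∣ W.frobeniusTrace p) (hf : IsNewformOf W f)
    (hκ : κ.IsCyclotomic) (hγ : κ.IsTopGenerator γ) (hγ' : IsCyclotomicVariable p γ)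
    (hv : (p : 𝓞 ℚ) ∈ v.asIdeal)
    (hg : κ.IsTopGenerator (resGalOfEmb (closureEmb (K := ℚ) (v.adicCompletion ℚ)) g))
    (hH : IsHondaSystem κ (closureEmb (K := ℚ) (v.adicCompletion ℚ)) W (W.frobeniusTrace p) g cneg c)
    (hL : IsSprungPair f p (W.frobeniusTrace p) Lsharp Lflat) (hL0 : chromaticL col Lsharp Lflat ≠ 0)
    (D₀ : SharpFlatSelmerDualData W κ γ (closureEmb (K := ℚ) (v.adicCompletion ℚ))
      (W.frobeniusTrace p) g c col) [Module.Finite (IwasawaAlgebra p) D₀.X]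
    (hX₀ : Module.IsTorsion (IwasawaAlgebra p) D₀.X) :
    ∃ n : ℕ, (p : IwasawaAlgebra p) ^ n * invol p (chromaticL col Lsharp Lflat) ∈ D₀.charIdeal := by
  obtain ⟨D⟩ := nonempty_sharpFlatSelmerDualData_rat W κ γ⁻¹ v g c col
  haveI : Module.Finite (IwasawaAlgebra p) D.X := (sharpFlatSelmerDualData_finite_inv_iff D₀ D).1 ‹_›
  have hX : Module.IsTorsion (IwasawaAlgebra p) D.X := (sharpFlatSelmerDualData_isTorsion_inv_iff D₀ D).1 hX₀
  obtain ⟨n, hn⟩ := rational h hp hgood hss hf hκ hγ hγ' hv hg hH hL hL0 D hX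
  refine ⟨n, ?_⟩
  have h' := (sharpFlatSelmerDualData_mem_charIdeal_inv_iff D₀ D _).1 hn
  rwa [map_mul, map_pow, map_natCast] at h'

/-- The integral clause READ ON A TREE-KEYED datum: under surjectivity of `ρ_{E,p^∞}`, **`ι(L^•_p(E, X)) ∈
char(D₀.X)`** for every key-`γ` datum `D₀` with `D₀.X` finitely generated `Λ`-torsion.
[cite: Sprung2012, Thm. 1.4 (p. 1486) and Thm. 7.16 (p. 1504)] [cite: Greenberg1989, §0 pp. 101–102 (S^ι)] -/
theorem invol_integral (h : thm716_sharpFlatCharIdeal_divisibility_contra) (hp : p ≠ 2)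
    (hgood : W.HasGoodReductionAtPrime p) (hss : (p : ℤ) ∣ W.frobeniusTrace p) (hf : IsNewformOf W f)
    (hκ : κ.IsCyclotomic) (hγ : κ.IsTopGenerator γ) (hγ' : IsCyclotomicVariable p γ)
    (hv : (p : 𝓞 ℚ) ∈ v.asIdeal)
    (hg : κ.IsTopGenerator (resGalOfEmb (closureEmb (K := ℚ) (v.adicCompletion ℚ)) g))
    (hH : IsHondaSystem κ (closureEmb (K := ℚ) (v.adicCompletion ℚ)) W (W.frobeniusTrace p) g cneg c)
    (hL : IsSprungPair f p (W.frobeniusTrace p) Lsharp Lflat) (hL0 : chromaticL col Lsharp Lflat ≠ 0)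
    (D₀ : SharpFlatSelmerDualData W κ γ (closureEmb (K := ℚ) (v.adicCompletion ℚ))
      (W.frobeniusTrace p) g c col) [Module.Finite (IwasawaAlgebra p) D₀.X]
    (hX₀ : Module.IsTorsion (IwasawaAlgebra p) D₀.X)
    (hsurj : ∀ m : ℕ, W.HasSurjectiveModNGaloisRep (p ^ m : ℕ)) :
    invol p (chromaticL col Lsharp Lflat) ∈ D₀.charIdeal := by
  obtain ⟨D⟩ := nonempty_sharpFlatSelmerDualData_rat W κ γ⁻¹ v g c col
  haveI : Module.Finite (IwasawaAlgebra p) D.X := (sharpFlatSelmerDualData_finite_inv_iff D₀ D).1 ‹_›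
  have hX : Module.IsTorsion (IwasawaAlgebra p) D.X := (sharpFlatSelmerDualData_isTorsion_inv_iff D₀ D).1 hX₀
  exact (sharpFlatSelmerDualData_mem_charIdeal_inv_iff D₀ D _).1
    (integral h hp hgood hss hf hκ hγ hγ' hv hg hH hL hL0 D hX hsurj)

end thm716_sharpFlatCharIdeal_divisibility_contra

end Literature.NumberTheory.EllipticCurves.Sprung2012

end
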